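import Summits.QuantumAdvantage.QuantumAdvantage.Theorems.CharDialFieldColA
import HarnessLib

/-!
# CharDial / JLinPeel — FIELD COLUMNS, part C: the full-pattern cuts of a column; the ROBUST SPARSE ESCAPE of `fieldY`
(route `CharDial`, item 32604; lens-6 node g18 §10.4 (d))

* `jk r k` — prefix parameter of the `k`-th FULL-PATTERN cut of column `r` of the table (`r < R`: power column; `r = R`: the constant
  column): `≡ r (mod R+1)`, `> sepM`; `jk_budget`: the cuts `p·jk r k + c` (`k < K`, `c < p`) exist under the HIGH-side budget
  `p·(sepM + (R+1)(K+2)) ≤ n+1`; `cutAt r k c` is that cut, `cutAt_div` / `colIdx_cutAt` / `cutAt_cast` / `cutAt_injective`;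
  `fieldCoef_full`: at a full-pattern parameter the canonical coefficient vector IS the column; `fieldY_cutAt`: the strategy there is the
  test `[c = col_r · u]`; `col_last`: column `R` is the constant `1`.
* `gcnt` — the COUNTING CUT (constant column, `k = 0`, residue `0`; fits under part A's budget `3·p·(R+1) ≤ n`): canonically
  `[#{i : u_i} ≡ 0 (mod p)]` (`fieldY_gcnt`).  ★ `cnt_coef_ne_zero` — RIGIDITY: in EVERY presentation of `fieldY p n α`, every coordinate
  outside the presented junta of the counting cut has NON-ZERO presented coefficient (part A's flip criterion `flip_zero` at base point
  `u = 0` with the singleton `{i}`: canonically the coefficient is `1 ≠ 0`).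
* ★★ `field_not_sparse` — ROBUST SPARSE ESCAPE: for every `α`, NO presentation of `fieldY p n α` (juntas of any size) meets the
  sparse-free-set dial's hypothesis, inlined verbatim from the annex (`∃ S, log₂ n ≤ #S ∧ ∀ g, #(S ∩ (J_g ∪ supp a_g)) ≤ √#S`), once
  `log₂ n ≥ 2` and `3·p·(R+1) ≤ n`: the counting cut charges ALL of `S`, and `#S ≤ √#S` forces `#S ≤ 1`.

Prop-free (hypotheses inlined), 0 sorry.  Part D (next file) does the HIGH side and assembles.
-/

set_option autoImplicit false

namespace Summit.QuantumAdvantage.AdviceFreeQNC0.JLinPeel.FieldCol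

open Finset MaskDial BlockDial

/-! #### (5) general full-pattern cuts: the `k`-th cut of a column, its budget, the strategy there -/
section Cuts
variable (p : ℕ) [hp : Fact p.Prime]

/-- prefix parameter of the `k`-th FULL-PATTERN cut of column `r` (a power column `r < R`, or the constant column `r = R`):
`jk r k ≡ r (mod R+1)` and `jk r k > sepM`. -/
def jk (n : ℕ) (r : Fin (rk n + 1)) (k : ℕ) : ℕ := (rk n + 1) * (NullDial.sepM p n / (rk n + 1) + 1 + k) + r.val

omit hp in
/-- `jk r k ≡ r (mod R+1)`. -/
theorem jk_mod (n : ℕ) (r : Fin (rk n + 1)) (k : ℕ) : jk p n r k % (rk n + 1) = r.val := by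
  unfold jk
  rw [Nat.mul_add_mod, Nat.mod_eq_of_lt r.isLt]

omit hp in
/-- `sepM ≤ jk r k`: the cut is full-pattern. -/
theorem sepM_le_jk (n : ℕ) (r : Fin (rk n + 1)) (k : ℕ) : NullDial.sepM p n ≤ jk p n r k := by
  unfold jk
  have h := Nat.lt_div_mul_add (a := NullDial.sepM p n) (b := rk n + 1) (by omega)
  have e : (rk n + 1) * (NullDial.sepM p n / (rk n + 1) + 1 + k)
      = NullDial.sepM p n / (rk n + 1) * (rk n + 1) + (rk n + 1) + (rk n + 1) * k := by ring
  rw [e]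
  omega

omit hp in
/-- the `k = 0` cut fits under the part-A budget `3·p·(R+1) ≤ n`. -/
theorem p_jk_zero_le (n : ℕ) (hn : 3 * p * (rk n + 1) ≤ n) (r : Fin (rk n + 1)) : p * jk p n r 0 ≤ n := by
  unfold jk
  have h1 : (rk n + 1) * (NullDial.sepM p n / (rk n + 1)) ≤ NullDial.sepM p n := by
    rw [mul_comm]; exact Nat.div_mul_le_self _ _
  have h2 := NullDial.p_mul_sepM_le p n
  have h3 : p * ((rk n + 1) * (NullDial.sepM p n / (rk n + 1) + 1 + 0) + r.val) ≤ p * (NullDial.sepM p n + 2 * (rk n + 1)) := by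
    apply Nat.mul_le_mul_left
    have := r.isLt
    have e : (rk n + 1) * (NullDial.sepM p n / (rk n + 1) + 1 + 0) = (rk n + 1) * (NullDial.sepM p n / (rk n + 1)) + (rk n + 1) := by
      ring
    omega
  have h4 : p * (NullDial.sepM p n + 2 * (rk n + 1)) = p * NullDial.sepM p n + 2 * (p * (rk n + 1)) := by ring
  have h5 : 3 * (n / 3) ≤ n := Nat.mul_div_le n 3
  have h6 : 3 * p * (rk n + 1) = 3 * (p * (rk n + 1)) := by ring
  omega

omit hp in
/-- the cut budget of the HIGH side: under `p·(sepM + (R+1)(K+2)) ≤ n+1` the cuts `p·jk r k + c` (`k < K`, `c < p`) exist. -/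
theorem jk_budget (n K : ℕ) (hbig : p * (NullDial.sepM p n + (rk n + 1) * (K + 2)) ≤ n + 1) (r : Fin (rk n + 1))
    {k : ℕ} (hk : k < K) : p * jk p n r k + p ≤ n + 1 := by
  unfold jk
  have h1 : (rk n + 1) * (NullDial.sepM p n / (rk n + 1)) ≤ NullDial.sepM p n := by
    rw [mul_comm]; exact Nat.div_mul_le_self _ _
  have h2 : (rk n + 1) * (k + 2) ≤ (rk n + 1) * (K + 2) := Nat.mul_le_mul_left _ (by omega)
  have e : (rk n + 1) * (NullDial.sepM p n / (rk n + 1) + 1 + k) + rk n + 1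
      = (rk n + 1) * (NullDial.sepM p n / (rk n + 1)) + (rk n + 1) * (k + 2) := by ring
  have h3 : (rk n + 1) * (NullDial.sepM p n / (rk n + 1) + 1 + k) + r.val + 1
      ≤ NullDial.sepM p n + (rk n + 1) * (K + 2) := by
    have := r.isLt
    omega
  calc p * ((rk n + 1) * (NullDial.sepM p n / (rk n + 1) + 1 + k) + r.val) + p
        = p * ((rk n + 1) * (NullDial.sepM p n / (rk n + 1) + 1 + k) + r.val + 1) := by ring
    _ ≤ p * (NullDial.sepM p n + (rk n + 1) * (K + 2)) := Nat.mul_le_mul_left _ h3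
    _ ≤ n + 1 := hbig

/-- the `k`-th cut of column `r` with residue `c`, as a cut of `Fin (n+1)`. -/
def cutAt (n K : ℕ) (hbig : p * (NullDial.sepM p n + (rk n + 1) * (K + 2)) ≤ n + 1) (r : Fin (rk n + 1))
    (k : Fin K) (c : Fin p) : Fin (n + 1) :=
  ⟨c.val + jk p n r k.val * p, by
    have h1 := jk_budget p n K hbig r k.isLt
    have h2 := c.isLt
    have e : jk p n r k.val * p = p * jk p n r k.val := mul_comm _ _
    omega⟩

omit hp in
/-- its value. -/
theorem cutAt_val (n K : ℕ) (hbig : p * (NullDial.sepM p n + (rk n + 1) * (K + 2)) ≤ n + 1) (r : Fin (rk n + 1))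
    (k : Fin K) (c : Fin p) : (cutAt p n K hbig r k c).val = c.val + jk p n r k.val * p := rfl

/-- its prefix parameter is `jk r k`. -/
theorem cutAt_div (n K : ℕ) (hbig : p * (NullDial.sepM p n + (rk n + 1) * (K + 2)) ≤ n + 1) (r : Fin (rk n + 1))
    (k : Fin K) (c : Fin p) : (cutAt p n K hbig r k c).val / p = jk p n r k.val := by
  rw [cutAt_val, Nat.add_mul_div_right _ _ hp.out.pos, Nat.div_eq_of_lt c.isLt, zero_add]

/-- its column is `r`. -/
theorem colIdx_cutAt (n K : ℕ) (hbig : p * (NullDial.sepM p n + (rk n + 1) * (K + 2)) ≤ n + 1) (r : Fin (rk n + 1))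
    (k : Fin K) (c : Fin p) : colIdx p n (cutAt p n K hbig r k c) = r := by
  ext
  show (cutAt p n K hbig r k c).val / p % (rk n + 1) = r.val
  rw [cutAt_div, jk_mod]

/-- its residue is `c`. -/
theorem cutAt_cast (n K : ℕ) (hbig : p * (NullDial.sepM p n + (rk n + 1) * (K + 2)) ≤ n + 1) (r : Fin (rk n + 1))
    (k : Fin K) (c : Fin p) : ((((cutAt p n K hbig r k c : Fin (n + 1)) : ℕ) : ZMod p)) = ((c.val : ℕ) : ZMod p) := by
  show (((c.val + jk p n r k.val * p : ℕ)) : ZMod p) = _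
  push_cast
  rw [ZMod.natCast_self, mul_zero, add_zero]

/-- distinct `k` give distinct cuts. -/
theorem cutAt_injective (n K : ℕ) (hbig : p * (NullDial.sepM p n + (rk n + 1) * (K + 2)) ≤ n + 1) (r : Fin (rk n + 1))
    (c : Fin p) : Function.Injective fun k : Fin K => cutAt p n K hbig r k c := by
  intro k k' hkk
  have h := congrArg Fin.val hkk
  simp only [cutAt_val] at h
  unfold jk at h
  apply Fin.ext
  have hp0 : 0 < p := hp.out.pos
  have h1 : ((rk n + 1) * (NullDial.sepM p n / (rk n + 1) + 1 + k.val) + r.val) * p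
      = ((rk n + 1) * (NullDial.sepM p n / (rk n + 1) + 1 + k'.val) + r.val) * p := by omega
  have h2 := Nat.eq_of_mul_eq_mul_right hp0 h1
  have h3 : (rk n + 1) * (NullDial.sepM p n / (rk n + 1) + 1 + k.val) = (rk n + 1) * (NullDial.sepM p n / (rk n + 1) + 1 + k'.val) := by
    omega
  have h4 := Nat.eq_of_mul_eq_mul_left (Nat.succ_pos (rk n)) h3
  omega

/-- at a full-pattern prefix parameter the canonical coefficient vector IS the column. -/
theorem fieldCoef_full (n : ℕ) (α : GaloisField p (rk n)) (q : ℕ) (hq : NullDial.sepM p n ≤ q) (r : Fin (rk n + 1)) (i : Fin n) :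
    fieldCoef p n α q r i = col p n α r i := by
  unfold fieldCoef
  have h1 : p * NullDial.sepM p n ≤ p * q := Nat.mul_le_mul_left _ hq
  split_ifs with ha hb
  · rfl
  · omega
  · rfl

/-- the strategy at the `k`-th cut of column `r`, residue `c`: the test `[c = col_r · u]`. -/
theorem fieldY_cutAt (n K : ℕ) (hbig : p * (NullDial.sepM p n + (rk n + 1) * (K + 2)) ≤ n + 1) (α : GaloisField p (rk n))
    (r : Fin (rk n + 1)) (k : Fin K) (c : Fin p) (u : Fin n → Bool) :
    fieldY p n α (cutAt p n K hbig r k c) u = decide (((c.val : ℕ) : ZMod p) = ∑ i, if u i then col p n α r i else 0) := by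
  unfold fieldY
  rw [cutAt_cast]
  have hc : fieldCoef p n α ((cutAt p n K hbig r k c).val / p) (colIdx p n (cutAt p n K hbig r k c)) = col p n α r := by
    funext i
    rw [cutAt_div, colIdx_cutAt, fieldCoef_full p n α _ (sepM_le_jk p n r k.val)]
  rw [hc]

/-- the constant column of the table. -/
theorem col_last (n : ℕ) (α : GaloisField p (rk n)) (i : Fin n) : col p n α ⟨rk n, Nat.lt_succ_self _⟩ i = 1 := by
  unfold col
  rw [dif_neg (lt_irrefl _)]

end Cuts

/-! #### (6) the ROBUST SPARSE ESCAPE: the counting cut reads every coordinate in every presentation -/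
section Sparse
variable (p : ℕ) [hp : Fact p.Prime]

/-- **the COUNTING CUT**: constant column, `k = 0`, residue `0`; canonically the test `[#{i : u_i} ≡ 0 (mod p)]`. -/
def gcnt (n : ℕ) (hn : 3 * p * (rk n + 1) ≤ n) : Fin (n + 1) :=
  ⟨p * jk p n ⟨rk n, Nat.lt_succ_self _⟩ 0, Nat.lt_succ_of_le (p_jk_zero_le p n hn _)⟩

/-- its residue is `0`. -/
theorem gcnt_cast (n : ℕ) (hn : 3 * p * (rk n + 1) ≤ n) : ((((gcnt p n hn : Fin (n + 1)) : ℕ) : ZMod p)) = 0 := by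
  show (((p * jk p n ⟨rk n, Nat.lt_succ_self _⟩ 0 : ℕ)) : ZMod p) = 0
  rw [Nat.cast_mul, ZMod.natCast_self, zero_mul]

/-- its prefix parameter. -/
theorem gcnt_div (n : ℕ) (hn : 3 * p * (rk n + 1) ≤ n) : (gcnt p n hn).val / p = jk p n ⟨rk n, Nat.lt_succ_self _⟩ 0 := by
  show p * jk p n ⟨rk n, Nat.lt_succ_self _⟩ 0 / p = _
  exact Nat.mul_div_cancel_left _ hp.out.pos

/-- its column is the constant column. -/
theorem colIdx_gcnt (n : ℕ) (hn : 3 * p * (rk n + 1) ≤ n) : colIdx p n (gcnt p n hn) = ⟨rk n, Nat.lt_succ_self _⟩ := by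
  ext
  show (gcnt p n hn).val / p % (rk n + 1) = rk n
  rw [gcnt_div, jk_mod]

/-- all its canonical coefficients are `1`. -/
theorem fieldCoef_gcnt (n : ℕ) (hn : 3 * p * (rk n + 1) ≤ n) (α : GaloisField p (rk n)) (i : Fin n) :
    fieldCoef p n α ((gcnt p n hn).val / p) (colIdx p n (gcnt p n hn)) i = 1 := by
  rw [gcnt_div, colIdx_gcnt, fieldCoef_full p n α _ (sepM_le_jk p n _ 0), col_last]

/-- the strategy at the counting cut. -/
theorem fieldY_gcnt (n : ℕ) (hn : 3 * p * (rk n + 1) ≤ n) (α : GaloisField p (rk n)) (u : Fin n → Bool) :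
    fieldY p n α (gcnt p n hn) u = decide ((0 : ZMod p) = ∑ i, if u i then (1 : ZMod p) else 0) := by
  unfold fieldY
  rw [gcnt_cast]
  have hc : fieldCoef p n α ((gcnt p n hn).val / p) (colIdx p n (gcnt p n hn)) = fun _ => (1 : ZMod p) := by
    funext i
    exact fieldCoef_gcnt p n hn α i
  rw [hc]

/-- **rigidity at the counting cut**: in EVERY presentation of `fieldY`, every coordinate outside the presented junta of the counting cut
has a NON-ZERO presented coefficient (flip criterion at base point `u = 0` with the singleton `{i}`: canonically `1 ≠ 0`). -/
theorem cnt_coef_ne_zero (n : ℕ) (hn : 3 * p * (rk n + 1) ≤ n) (α : GaloisField p (rk n)) (D : JLinData p n)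
    (hD : D.strat = fieldY p n α) (i : Fin n) (hiJ : i ∉ D.J (gcnt p n hn)) : D.a (gcnt p n hn) i ≠ 0 := by
  classical
  intro h0
  have h := flip_zero D (gcnt p n hn) (fun _ => (1 : ZMod p)) (fun u => by rw [hD]; exact fieldY_gcnt p n hn α u)
    {i} (fun j hj => by rw [Finset.mem_singleton] at hj; rw [hj]; exact hiJ) (by rw [Finset.sum_singleton]; exact h0)
  rw [Finset.sum_singleton] at h
  exact one_ne_zero h

/-- **ROBUST SPARSE ESCAPE of `fieldY`**: no `log₂ n`-junta-or-not presentation of `fieldY p n α` meets the sparse-free-set dial's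
hypothesis (inlined verbatim: a set `S` of `≥ log₂ n` coordinates meeting every cut's junta ∪ form-support in `≤ √#S` points), once
`log₂ n ≥ 2` and `3·p·(R+1) ≤ n` — the counting cut charges ALL of `S`. (No genericity of `α` and no junta bound are needed.) -/
theorem field_not_sparse (n : ℕ) (hn : 3 * p * (rk n + 1) ≤ n) (hL : 2 ≤ Nat.log 2 n) (α : GaloisField p (rk n))
    (D : JLinData p n) (hD : D.strat = fieldY p n α) :
    ¬ (∃ S : Finset (Fin n), Nat.log 2 n ≤ S.card ∧
        ∀ g, (S.filter fun i => i ∈ D.J g ∨ D.a g i ≠ 0).card ≤ Nat.sqrt S.card) := by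
  classical
  rintro ⟨S, hS, hsp⟩
  have h := hsp (gcnt p n hn)
  have hfull : (S.filter fun i => i ∈ D.J (gcnt p n hn) ∨ D.a (gcnt p n hn) i ≠ 0) = S := by
    apply Finset.filter_true_of_mem
    intro i _
    by_cases hi : i ∈ D.J (gcnt p n hn)
    · exact Or.inl hi
    · exact Or.inr (cnt_coef_ne_zero p n hn α D hD i hi)
  rw [hfull] at h
  have := Nat.sqrt_lt_self (show 1 < S.card by omega)
  omega

end Sparse

end Summit.QuantumAdvantage.AdviceFreeQNC0.JLinPeel.FieldCol
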